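import Summits.Ventures.LatticeQCDFlow.Exactness.Phi4FlowHMCHybridHarmonicMean
import Summits.Ventures.LatticeQCDFlow.Exactness.RandomisedHMC
import HarnessLib

/-!
# Randomised HMC trajectory lengths (and step sizes): `τ_int` of the randomised update is never worse than the HARMONIC MEAN of the fixed-parameter updates — `τ_K̄(g) + ½ ≤ 1/Σ_N w_N/(τ_{K_N}(g) + ½)` on bounded observables

HONEST FRAMING: exact (Metropolis-corrected) sampling algorithms for lattice gauge theory;
figures of merit are autocorrelation/cost numbers at stated couplings and volumes; no
continuum-physics claim.  (SCALAR calibration rung S0-A: not a gauge result.)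

Venture `LatticeQCDFlow` (cell pub-lqcd), topic `Exactness`; FANOUT row 2 (`s0-phi4`, HMC arm).  NEW
WORK of the cell: the UPPER-bound companion of the tree's `RandomisedHMC` (which proves exactness,
reversibility, contraction and the averaged mean-squared-jump FLOOR for the randomised update
`hmcOpRandom J λ δ S w f = Σ_{N∈S} w_N K_N f`, Mackenzie 1989 NAMED ONLY).  By the cell's `RevOp`
harmonic-mean theorem (`ReversibleMixtureHarmonicMean`) and row 2's packaged `RevOp` hypotheses of
the HMC update on the bounded observables (`hmcOpPhi4_revOp_bddObs`), for lattice φ⁴ with ANY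
`λ > 0` and real couplings `J`:

* **`phi4HMCFamily_tauInt_add_half_le_harmonicMean`** — any finite family of HMC updates
  `Kᵢ = hmcOpPhi4 J λ δᵢ Nᵢ` (trajectory lengths AND step sizes may both vary), weights `αᵢ > 0`,
  `Σ αᵢ = 1`, the randomised update `M f = Σ αᵢ Kᵢ f`; `g ∈ BddObs`, `Var g > 0`, normalised
  autocorrelation series of `g − ⟨g⟩` summable under each `Kᵢ` and under `M` ⇒
  **`τ_M(g) + ½ ≤ 1/Σᵢ αᵢ/(τ_{Kᵢ}(g) + ½)`** (≤ the arithmetic mean `Σ αᵢ(τ_{Kᵢ} + ½)`);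
* **`hmcOpRandom_tauInt_add_half_le_harmonicMean`** — the tree's randomised-length update
  `hmcOpRandom J λ δ S w` (`S` a nonempty finite set of lengths, `w_N > 0` on `S`, `Σ_{N∈S} w_N = 1`):
  `τ_K̄(g) + ½ ≤ 1/Σ_{N∈S} w_N/(τ_{K_N}(g) + ½)`.

Reading (no numerics implied): per UPDATE, randomising over trajectory lengths can never be worse than
the harmonic mean of what the fixed lengths achieve, observable by observable — the complement of the
floor `τ ≥ 2Var/E_w[D_N] − ½` of `RandomisedHMC`.  Nothing is cited as a fact.

NOT CLAIMED: cost (a length-`N` trajectory costs `N` force evaluations — the bound is per update, not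
per unit cost); that randomisation beats the best fixed length; summability for any run; `PolyObs`
(the packaged hypotheses used here are the bounded-observable ones); any value for any run.
-/

namespace Summit.Ventures.LatticeQCDFlow.Exactness

open Real MeasureTheory Filter Finset Topology
open Summit.Ventures.LatticeQCDFlow.Scoring

variable {n : ℕ}

/-- **A FINITE FAMILY OF HMC UPDATES, RANDOMISED: `τ + ½ ≤` THE WEIGHTED HARMONIC MEAN.**
`Kᵢ = hmcOpPhi4 J λ δᵢ Nᵢ`, `M f = Σ αᵢ Kᵢ f` (`αᵢ > 0`, `Σ αᵢ = 1`), `g ∈ BddObs`, `Var g > 0`, series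
summable under each `Kᵢ` and under `M`. -/
theorem phi4HMCFamily_tauInt_add_half_le_harmonicMean {lam : ℝ} (hlam : 0 < lam)
    (J : Fin (n + 1) → Fin (n + 1) → ℝ) {ι : Type*} [Fintype ι] [Nonempty ι]
    (δ : ι → ℝ) (N : ι → ℕ) {α : ι → ℝ} (hα : ∀ i, 0 < α i) (hα1 : ∑ i, α i = 1)
    {M : ((Fin (n + 1) → ℝ) → ℝ) → ((Fin (n + 1) → ℝ) → ℝ)}
    (hM : ∀ f φ, M f φ = ∑ i, α i * hmcOpPhi4 J lam (δ i) (N i) f φ)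
    {g : (Fin (n + 1) → ℝ) → ℝ} (hg : BddObs g)
    (hP : 0 < ∫ φ, (g φ - gibbsExpect J lam g) ^ 2 * gibbsWeight J lam φ)
    (hs : ∀ i, Summable fun k => (∫ φ, (g φ - gibbsExpect J lam g)
        * ((hmcOpPhi4 J lam (δ i) (N i))^[k + 1] (fun ψ => g ψ - gibbsExpect J lam g)) φ
          * gibbsWeight J lam φ)
        / ∫ φ, (g φ - gibbsExpect J lam g) ^ 2 * gibbsWeight J lam φ)
    (hsM : Summable fun k => (∫ φ, (g φ - gibbsExpect J lam g)
        * (M^[k + 1] (fun ψ => g ψ - gibbsExpect J lam g)) φ * gibbsWeight J lam φ)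
        / ∫ φ, (g φ - gibbsExpect J lam g) ^ 2 * gibbsWeight J lam φ) :
    tauInt (fun k => (∫ φ, (g φ - gibbsExpect J lam g)
          * (M^[k] (fun ψ => g ψ - gibbsExpect J lam g)) φ * gibbsWeight J lam φ)
          / ∫ φ, (g φ - gibbsExpect J lam g) ^ 2 * gibbsWeight J lam φ) + 1 / 2
      ≤ 1 / ∑ i, α i / (tauInt (fun k => (∫ φ, (g φ - gibbsExpect J lam g)
          * ((hmcOpPhi4 J lam (δ i) (N i))^[k] (fun ψ => g ψ - gibbsExpect J lam g)) φ
            * gibbsWeight J lam φ)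
          / ∫ φ, (g φ - gibbsExpect J lam g) ^ 2 * gibbsWeight J lam φ) + 1 / 2) := by
  have hco := latticePhi4Action_coercive hlam J
  have hpk := fun i => hmcOpPhi4_revOp_bddObs hlam J (δ i) (N i)
  have hgc := bddObs_sub_gibbsExpect J lam hg
  have h := RevOp.tauInt_mixN_add_half_le_harmonicMean (μ := volume) (A := BddObs)
    (K := fun i => hmcOpPhi4 J lam (δ i) (N i)) (M := M) (α := α) (w := gibbsWeight J lam)
    (fun φ => (gibbsWeight_pos J lam φ).le)
    (fun f h hf hh => bddObs_integrable_mul_mul_gibbsWeight one_pos hco hf hh)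
    (fun f h c hf hh => bddObs_add_mul hf hh c)
    (fun i => (hpk i).1) (fun i => (hpk i).2.1) (fun i => (hpk i).2.2.1) (fun i => (hpk i).2.2.2)
    hM hα hα1 hgc hP (S := Finset.univ) Finset.univ_nonempty (fun i _ => hs i) hsM
  simpa using h

/-- **THE TREE'S RANDOMISED-LENGTH UPDATE `hmcOpRandom J λ δ S w`**: `S` nonempty, `w_N > 0` on `S`,
`Σ_{N∈S} w_N = 1`, `g ∈ BddObs`, `Var g > 0`, series summable under each `K_N` (`N ∈ S`) and under
`K̄` ⇒ `τ_K̄(g) + ½ ≤ 1/Σ_{N∈S} w_N/(τ_{K_N}(g) + ½)`. -/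
theorem hmcOpRandom_tauInt_add_half_le_harmonicMean {lam : ℝ} (hlam : 0 < lam)
    (J : Fin (n + 1) → Fin (n + 1) → ℝ) (δ : ℝ) {S : Finset ℕ} (hS : S.Nonempty) {w : ℕ → ℝ}
    (hw : ∀ N ∈ S, 0 < w N) (hw1 : ∑ N ∈ S, w N = 1)
    {g : (Fin (n + 1) → ℝ) → ℝ} (hg : BddObs g)
    (hP : 0 < ∫ φ, (g φ - gibbsExpect J lam g) ^ 2 * gibbsWeight J lam φ)
    (hs : ∀ N ∈ S, Summable fun k => (∫ φ, (g φ - gibbsExpect J lam g)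
        * ((hmcOpPhi4 J lam δ N)^[k + 1] (fun ψ => g ψ - gibbsExpect J lam g)) φ
          * gibbsWeight J lam φ)
        / ∫ φ, (g φ - gibbsExpect J lam g) ^ 2 * gibbsWeight J lam φ)
    (hsM : Summable fun k => (∫ φ, (g φ - gibbsExpect J lam g)
        * ((hmcOpRandom J lam δ S w)^[k + 1] (fun ψ => g ψ - gibbsExpect J lam g)) φ
          * gibbsWeight J lam φ)
        / ∫ φ, (g φ - gibbsExpect J lam g) ^ 2 * gibbsWeight J lam φ) :
    tauInt (fun k => (∫ φ, (g φ - gibbsExpect J lam g)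
          * ((hmcOpRandom J lam δ S w)^[k] (fun ψ => g ψ - gibbsExpect J lam g)) φ
            * gibbsWeight J lam φ)
          / ∫ φ, (g φ - gibbsExpect J lam g) ^ 2 * gibbsWeight J lam φ) + 1 / 2
      ≤ 1 / ∑ N ∈ S, w N / (tauInt (fun k => (∫ φ, (g φ - gibbsExpect J lam g)
          * ((hmcOpPhi4 J lam δ N)^[k] (fun ψ => g ψ - gibbsExpect J lam g)) φ
            * gibbsWeight J lam φ)
          / ∫ φ, (g φ - gibbsExpect J lam g) ^ 2 * gibbsWeight J lam φ) + 1 / 2) := by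
  haveI : Nonempty (S : Type) := hS.coe_sort
  have hM : ∀ f φ, hmcOpRandom J lam δ S w f φ
      = ∑ i : S, w i * hmcOpPhi4 J lam δ (i : ℕ) f φ := fun f φ => by
    unfold hmcOpRandom
    exact (Finset.sum_coe_sort S (fun N => w N * hmcOpPhi4 J lam δ N f φ)).symm
  have h := phi4HMCFamily_tauInt_add_half_le_harmonicMean hlam J (ι := S) (fun _ => δ)
    (fun i => (i : ℕ)) (α := fun i => w i) (fun i => hw i i.2)
    (by rw [Finset.sum_coe_sort S w]; exact hw1) hM hg hP (fun i => hs i i.2) hsM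
  rw [Finset.sum_coe_sort S (fun N => w N / (tauInt (fun k => (∫ φ, (g φ - gibbsExpect J lam g)
          * ((hmcOpPhi4 J lam δ N)^[k] (fun ψ => g ψ - gibbsExpect J lam g)) φ
            * gibbsWeight J lam φ)
          / ∫ φ, (g φ - gibbsExpect J lam g) ^ 2 * gibbsWeight J lam φ) + 1 / 2))] at h
  exact h

end Summit.Ventures.LatticeQCDFlow.Exactness
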